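import Summits.KontsevichZagierPeriods.KontsevichZagierPeriods.Theses.InequalityCost
import Literature.NumberTheory.Transcendental.KZTameCert

/-!
# `BoundedCost` (stmt-KontsevichZagierPeriods-11056, route InequalityCost, crux rank 3) — birth skeleton

Crux (verbatim the route decl `…Theses.InequalityCost.BoundedCost`, rev 3): for TAME VOLUME FORMS
`A B : KZ.IntegralRep n` (domains in the box `[−N₀, N₀]ⁿ`, integrand `1` on the domain) with
`A.value = B.value` there is ONE size `N` such that for EVERY rational `ε ∈ (0, 1)` a one-sided
`ε`-certificate of size `≤ N` exists: a formal identity `[A] − [B] + [([0,ε] ⊆ ℝ¹, 1)] − [p] = Σ_{i<N} mᵢ`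
in the free abelian group on raw real pairs, `p` an `N`-tame pair with integrand `≥ 0`, each `mᵢ`
`±` an `N`-tame instance of one of the four KZ moves, description complexity measured in the
Basu–Pollack–Roy gauge (unions of `≤ N` basic pieces cut out by `N` real polynomial equations and `N`
strict inequalities of total degree `≤ N`). The crux carries this calculus inline as a `let`-prefix;
below it is NAMED (`BprCplx`, `BprAdm`, `bprMoves`, `BprCert`, literal bodies) and `boundedCost_iff`
(`Iff.rfl`) certifies that the names are the crux's bodies.

Since the crux was filed, definition request D2 LANDED in the Literature as
`Literature/NumberTheory/Transcendental/KZTameCert.lean`: the same calculus (`KZ.RawPair`,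
`KZ.rawGen`, `KZ.volGen`, `KZ.epsInterval`, `KZ.TameAdm`, `KZ.tameMoves`, `KZ.TameCert N c ε`,
`KZ.inequalityCost c ε : ℕ∞`) but in the GÖDEL gauge of rev 1/2 (`KZ.TameCplx`: a parameter-free
ordered-ring formula of code `≤ N` with `≤ N` real parameters), with proved API (`TameCert.mono`,
soundness `TameCert.neg_le_value_sub`, `inequalityCost_le_iff`, bounded cost of tame-equivalent
combinations `exists_forall_inequalityCost_le_of_mem_closure`) and an explicit list of what it does
NOT prove ("monotonicity in `ε` by padding with a box, …, first-order definability of the level sets").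

Line ("liminf + pad + gauge" — the crux read as a statement about the tree's cost function
`N_c(ε) = KZ.inequalityCost (volGen n σA − volGen n σB) ε`; nothing new is filed):

* `stub_cofinalBoundedCost` — THE THESIS PROPER, WEAKENED TO A LIMINF (conjecture-grade, the
  transcendence-bearing stub): for bounded `ℚ`-semialgebraic `σA, σB ⊆ ℝⁿ` of equal volume the
  inequality cost does not tend to infinity at `0⁺`: `∃ N, ∀ δ > 0, ∃ ε ∈ (0, δ), N_c(ε) ≤ N`.
  This is exactly what a positive engine of the kind the route header foresees would deliver
  (self-similar packings along a geometric ladder `ε₀λᵏ` give bounded cost at COFINALLY many scales,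
  not at all scales), and it is stated over raw sets and volumes, the `KZ.IntegralRep` wrapper and the
  `value = volume` bookkeeping being discharged in the composition. Why it might fail = the crux's own
  risk (for an inaccessible pair — route Neg's triplication pair 0312 — `N_c(ε) → ∞` IS a disproof of
  Conjecture 1 for that pair modulo the squeeze); honest status: open problem, summit-strength modulo
  `TameSqueeze` + tame conservativity. Size: conjecture.
* `stub_padScale` — MONOTONICITY OF THE COST IN `ε` (pad by a box; provable now, the first entry of
  KZTameCert's "NOT here" list and of the route's D2 API wish-list): `∀ N, ∃ N', ∀ c ε ε'`,
  `0 ≤ ε ≤ ε' ≤ 1 → N_c(ε) ≤ N → N_c(ε') ≤ N'`, UNIFORMLY in `c, ε, ε'`. Construction: split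
  `[0, ε'] = [0, ε] ∪ [ε, ε']` (one tame domain-additivity move, overlap `{ε}` null), lift the slab
  `[ε, ε']` to the dimension of the positive pair `p` by `≤ N` Newton–Leibniz moves with the linear
  primitive `F(x, s) = s`, translate it off the box `[−N, N]ᵏ` (one change of variables), and glue it to
  `p` by one more domain-additivity move; all templates have bounded code, so `N' = N'(N)`. Size M/L
  (Lean bookkeeping over `KZ.TameAdm` / `KZ.tameMoves`; `KZ.TameCert.of_sub_eq_sum` is the pattern).
* `stub_gaugeTransfer` — GÖDEL GAUGE ⇒ BASU–POLLACK–ROY GAUGE (provable now; the rev-3 cone repair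
  asserted "the two `∃N`-statements are equivalent, `N ↦ g(N)` by quantifier elimination,
  BasuPollackRoy2006 Thm 2.77" in prose only — this stub is the direction the crux needs, as a lemma):
  `∀ N, ∃ N', ∀ c ε, KZ.TameCert N c ε → BprCert N' c ε`. The certificate data `(p, m)` are kept; only
  admissibility is re-proved, i.e. `KZ.TameCplx N k S → BprCplx N' k S` uniformly over the finitely
  many templates `φ` of code `≤ N` in dimension `k ≤ 2N` (Tarski–Seidenberg ONCE on the parameter
  space: `{(x, θ) | φ}` is `∅`-definable hence `ℚ`-semialgebraic (tree:
  `isSemialgebraic_of_definable`, `TameCplx.isSemialgebraic`), hence a finite union of basic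
  semialgebraic pieces (tree: `IsBasicSemialgebraic`, `exists_finset_eq_biUnion`); specialising the
  parameters `θ` gives real polynomials of the same number and degree for every fibre; pad pieces with
  `Q = 0` and slots with `P = 0`, `Q = 1`). Size L.

Composition `BoundedCost_of : stub₁-sig → stub₂-sig → stub₃-sig → BoundedCost` (sorry-free): for tame
volume forms `A, B` the values are the (finite: domains lie in a compact box) volumes of the domains,
so `volume A.domain = volume B.domain`; `stub_cofinalBoundedCost` gives a size `N₁` with certificates at
arbitrarily small scales; for a rational `ε ∈ (0,1)` pick such a scale `ε₀ < ε`, pad the certificate up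
to `ε` (`stub_padScale`, size `N₂(N₁)`), and change the gauge (`stub_gaugeTransfer`, size `N₃(N₂)`):
`N₃` is uniform in `ε`. `BoundedCost_skeleton : BoundedCost` feeds the three stubs in.

Disproof used: none on file for this crux (`ledger crux ls stmt-KontsevichZagierPeriods-11056`: no
workfiles, no `Disproof.lean`, no `Theorems/…/Negative/*`); `ledger negatives --problem
KontsevichZagierPeriods` has one entry (KinematicPlaneConvex, stmt-5394), unrelated. Item evidence read:
refuter crux-attack (survives; mirror-defs + `Iff.rfl` bridge pattern, reused here), grounder (NEW /
open-problem strength; tree pointer `IsBasicSemialgebraic`, used in the plan of `stub_gaugeTransfer`).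
All statements are over existing declarations (`Literature.NumberTheory.Transcendental.KZ.*` of
`KZCalculus` / `KZTameCert`, `Literature.ModelTheory.ExponentialFields.IsSemialgebraic`, Mathlib) plus
the four literal-body names of this file.
-/

set_option linter.dupNamespace false

namespace Summit.KontsevichZagierPeriods.KontsevichZagierPeriods.Cruxes.BoundedCost.Birth

open scoped BigOperators
open MeasureTheory Set
open Literature.NumberTheory.Transcendental
open Summit.KontsevichZagierPeriods.KontsevichZagierPeriods.Theses.InequalityCost (BoundedCost)

-- BEGIN VOCAB (copied verbatim into the BC3 probe files)
/-! ### The crux's certificate calculus (Basu–Pollack–Roy gauge), named — literal bodies -/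

/-- **Description complexity `≤ N` in the Basu–Pollack–Roy gauge** (verbatim the `let Cplx` of the
crux): `S ⊆ ℝᵏ` is the union of `N` basic pieces `{P_i1 = … = P_iN = 0, Q_i1 > 0, …, Q_iN > 0}` cut out
by REAL polynomials of total degree `≤ N`. [cite: BasuPollackRoy2006, §2.3] -/
def BprCplx (N k : ℕ) (S : Set (Fin k → ℝ)) : Prop :=
  ∃ (P Q : Fin N → Fin N → MvPolynomial (Fin k) ℝ),
    (∀ i j, (P i j).totalDegree ≤ N ∧ (Q i j).totalDegree ≤ N) ∧
      S = ⋃ i, {x | (∀ j, MvPolynomial.eval x (P i j) = 0) ∧ ∀ j, 0 < MvPolynomial.eval x (Q i j)}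

/-- **`N`-tameness in the BPR gauge** (verbatim the `let Adm` of the crux, on the projections of a raw
pair `x = ⟨k, σ, f⟩ : KZ.RawPair`): `k ≤ N`, domain in `[−N, N]ᵏ`, `|f| ≤ N` on the domain, `f = 0` off
it, and BPR complexity `≤ N` of the domain and of the graph. [cite: KontsevichZagier2001, §1.2] -/
def BprAdm (N : ℕ) (x : KZ.RawPair) : Prop :=
  x.1 ≤ N ∧ (∀ z ∈ x.2.1, (∀ i, |z i| ≤ N) ∧ |x.2.2 z| ≤ N) ∧ (∀ z ∉ x.2.1, x.2.2 z = 0) ∧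
    BprCplx N x.1 x.2.1 ∧
      BprCplx N (x.1 + 1) {w : Fin (x.1 + 1) → ℝ | Fin.init w ∈ x.2.1 ∧ w (Fin.last x.1) = x.2.2 (Fin.init w)}

/-- **The tame moves of level `N` in the BPR gauge** (verbatim the `let Moves` of the crux, with
`o ⟨k, σ, f⟩ = KZ.rawGen k σ f`): domain additivity ∪ integrand additivity ∪ change of variables ∪
Newton–Leibniz, every datum `N`-tame. [cite: KontsevichZagier2001, §1.2] -/
def bprMoves (N : ℕ) : Set KZ.RawFormal :=
  {c | ∃ (k : ℕ) (σ σ₁ σ₂ : Set (Fin k → ℝ)) (f f₁ f₂ : (Fin k → ℝ) → ℝ),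
      BprAdm N ⟨k, σ, f⟩ ∧ BprAdm N ⟨k, σ₁, f₁⟩ ∧ BprAdm N ⟨k, σ₂, f₂⟩ ∧ σ = σ₁ ∪ σ₂ ∧
        MeasureTheory.volume (σ₁ ∩ σ₂) = 0 ∧ Set.EqOn f f₁ σ₁ ∧ Set.EqOn f f₂ σ₂ ∧
          c = KZ.rawGen k σ f - KZ.rawGen k σ₁ f₁ - KZ.rawGen k σ₂ f₂} ∪
  {c | ∃ (k : ℕ) (σ : Set (Fin k → ℝ)) (f f₁ f₂ : (Fin k → ℝ) → ℝ),
      BprAdm N ⟨k, σ, f⟩ ∧ BprAdm N ⟨k, σ, f₁⟩ ∧ BprAdm N ⟨k, σ, f₂⟩ ∧ Set.EqOn f (f₁ + f₂) σ ∧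
        c = KZ.rawGen k σ f - KZ.rawGen k σ f₁ - KZ.rawGen k σ f₂} ∪
  {c | ∃ (k : ℕ) (σ σ' : Set (Fin k → ℝ)) (f f' : (Fin k → ℝ) → ℝ) (Φ : (Fin k → ℝ) → (Fin k → ℝ))
      (Φ' : (Fin k → ℝ) → (Fin k → ℝ) →L[ℝ] (Fin k → ℝ)),
      BprAdm N ⟨k, σ, f⟩ ∧ BprAdm N ⟨k, σ', f'⟩ ∧
        BprCplx N (k + k) {w : Fin (k + k) → ℝ | (fun i : Fin k => w (Fin.castAdd k i)) ∈ σ ∧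
          (fun i : Fin k => w (Fin.natAdd k i)) = Φ (fun i : Fin k => w (Fin.castAdd k i))} ∧
        (∀ x ∈ σ, HasFDerivWithinAt Φ (Φ' x) σ x) ∧ Set.InjOn Φ σ ∧ σ' = Φ '' σ ∧
          (∀ x ∈ σ, f x = f' (Φ x) * |(Φ' x).det|) ∧ c = KZ.rawGen k σ f - KZ.rawGen k σ' f'} ∪
  {c | ∃ (k : ℕ) (β : Set (Fin (k + 1) → ℝ)) (g : (Fin (k + 1) → ℝ) → ℝ) (τ : Set (Fin k → ℝ))
      (h a b : (Fin k → ℝ) → ℝ) (F : (Fin (k + 1) → ℝ) → ℝ),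
      BprAdm N ⟨k + 1, β, g⟩ ∧ BprAdm N ⟨k, τ, h⟩ ∧
        BprCplx N (k + 1) {w : Fin (k + 1) → ℝ | Fin.init w ∈ τ ∧ w (Fin.last k) = a (Fin.init w)} ∧
        BprCplx N (k + 1) {w : Fin (k + 1) → ℝ | Fin.init w ∈ τ ∧ w (Fin.last k) = b (Fin.init w)} ∧
        BprCplx N (k + 2) {w : Fin (k + 2) → ℝ | Fin.init w ∈ β ∧ w (Fin.last (k + 1)) = F (Fin.init w)} ∧
        (∀ z ∈ β, |F z| ≤ N) ∧ (∀ x ∈ τ, a x ≤ b x) ∧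
        β = {z : Fin (k + 1) → ℝ | Fin.init z ∈ τ ∧ a (Fin.init z) ≤ z (Fin.last k) ∧ z (Fin.last k) ≤ b (Fin.init z)} ∧
        (∀ x ∈ τ, ContinuousOn (fun s : ℝ => F (Fin.snoc x s)) (Set.Icc (a x) (b x))) ∧
        (∀ x ∈ τ, ∀ s ∈ Set.Ioo (a x) (b x), HasDerivAt (fun s : ℝ => F (Fin.snoc x s)) (g (Fin.snoc x s)) s) ∧
        (∀ x ∈ τ, h x = F (Fin.snoc x (b x)) - F (Fin.snoc x (a x))) ∧
          c = KZ.rawGen (k + 1) β g - KZ.rawGen k τ h}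

/-- **One-sided `ε`-certificate of size `≤ N` in the BPR gauge** for a formal combination `c` of raw
real pairs (verbatim the `let Cert` of the crux, which is the instance
`c = KZ.volGen n σA − KZ.volGen n σB`): `c + [([0, ε] ⊆ ℝ¹, 1)] − [p] = Σ_{i<N} mᵢ` with `p` an `N`-tame
pair with integrand `≥ 0` and `mᵢ ∈ ±bprMoves N ∪ {0}`. The BPR twin of the tree's `KZ.TameCert`.
[cite: Viusos2020, §4 (Lemmas 4.1–4.3, Remark 4.1)] -/
def BprCert (N : ℕ) (c : KZ.RawFormal) (ε : ℝ) : Prop :=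
  ∃ (kp : ℕ) (πp : Set (Fin kp → ℝ)) (gp : (Fin kp → ℝ) → ℝ) (m : Fin N → KZ.RawFormal),
    BprAdm N ⟨kp, πp, gp⟩ ∧ (∀ z ∈ πp, 0 ≤ gp z) ∧ (∀ i, m i ∈ bprMoves N ∨ -m i ∈ bprMoves N ∨ m i = 0) ∧
      c + KZ.volGen 1 (KZ.epsInterval ε) - KZ.rawGen kp πp gp = ∑ i, m i

-- END VOCAB

/-- **The crux through the named vocabulary** — DEFINITIONAL (`Iff.rfl`): `BoundedCost` says that for
tame volume forms `A, B` of equal value one size `N` certifies `volGen n A.domain − volGen n B.domain`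
at every rational scale `ε ∈ (0, 1)` in the BPR gauge. This certifies that `BprCplx` / `BprAdm` /
`bprMoves` / `BprCert` are literally the crux's `let`-bodies. [cite: KontsevichZagier2001, §1.2] -/
theorem boundedCost_iff :
    BoundedCost ↔
      ∀ ⦃n : ℕ⦄ (N₀ : ℕ) (A B : KZ.IntegralRep n), (∀ x ∈ A.domain, ∀ i, |x i| ≤ N₀) →
        Set.EqOn A.integrand 1 A.domain → (∀ x ∈ B.domain, ∀ i, |x i| ≤ N₀) →
        Set.EqOn B.integrand 1 B.domain → A.value = B.value →
          ∃ N : ℕ, ∀ ε : ℚ, 0 < ε → ε < 1 → BprCert N (KZ.volGen n A.domain - KZ.volGen n B.domain) ε :=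
  Iff.rfl

/-! ### The three statements of the line (named; each is registered below as a `stub_…`) -/

/-- **(G) Gauge transfer**, Gödel gauge ⇒ BPR gauge, uniformly in the size: the statement of
`stub_gaugeTransfer`. [cite: BasuPollackRoy2006, Thm 2.77 and §2.3] -/
def GaugeTransfer : Prop :=
  ∀ N : ℕ, ∃ N' : ℕ, ∀ (c : KZ.RawFormal) (ε : ℝ), KZ.TameCert N c ε → BprCert N' c ε

/-- **(P) Padding in the scale**: monotonicity of the inequality cost in `ε`, uniformly in the size —
the statement of `stub_padScale`. [cite: Viusos2020, §4 (Remark 4.1)] -/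
def PadScale : Prop :=
  ∀ N : ℕ, ∃ N' : ℕ, ∀ (c : KZ.RawFormal) (ε ε' : ℝ), 0 ≤ ε → ε ≤ ε' → ε' ≤ 1 →
    KZ.inequalityCost c ε ≤ N → KZ.inequalityCost c ε' ≤ N'

/-- **(C) Cofinal bounded cost** (`liminf_{ε→0⁺} N_c(ε) < ∞` for bounded `ℚ`-semialgebraic sets of
equal volume) — the statement of `stub_cofinalBoundedCost`; OPEN, conjecture-grade.
[cite: Viusos2020, §4 (Lemmas 4.1–4.3, Remark 4.1)] [cite: KontsevichZagier2001, §1.2 Conjecture 1] -/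
def CofinalBoundedCost : Prop :=
  ∀ (n N₀ : ℕ) (σA σB : Set (Fin n → ℝ)),
    Literature.ModelTheory.ExponentialFields.IsSemialgebraic ℚ σA →
    Literature.ModelTheory.ExponentialFields.IsSemialgebraic ℚ σB →
    (∀ x ∈ σA, ∀ i, |x i| ≤ (N₀ : ℝ)) → (∀ x ∈ σB, ∀ i, |x i| ≤ (N₀ : ℝ)) →
    MeasureTheory.volume σA = MeasureTheory.volume σB →
      ∃ N : ℕ, ∀ δ : ℝ, 0 < δ → ∃ ε : ℝ, 0 < ε ∧ ε < δ ∧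
        KZ.inequalityCost (KZ.volGen n σA - KZ.volGen n σB) ε ≤ N

/-! ### Registered stubs (the only `sorry`s of this file) -/

/-- **STUB S1 — GÖDEL GAUGE ⇒ BPR GAUGE** (provable now; size L). A one-sided certificate of size `N`
in the tree's gauge (`KZ.TameCert`: every set / graph is `{x | φ(x, θ)}` for a parameter-free
ordered-ring formula `φ` of code `≤ N` with `≤ N` real parameters) is a certificate of size `N'` in the
crux's Basu–Pollack–Roy gauge, with `N'` depending on `N` ONLY. Plan: keep the data `(p, m)`; re-prove
admissibility via `KZ.TameCplx N k S → BprCplx N' k S`, uniform over the finitely many templates of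
code `≤ N` in dimension `k ≤ 2N` — quantifier elimination once on the parameter space
(`isSemialgebraic_of_definable`, `TameCplx.isSemialgebraic`), finite union of basic pieces
(`IsBasicSemialgebraic`, `exists_finset_eq_biUnion`), specialise the parameters, pad pieces (`Q = 0`)
and slots (`P = 0`, `Q = 1`). This is the direction of the rev-3 cone repair's prose claim "the two
`∃N`-statements are equivalent, `N ↦ g(N)`". Why it might fail: only by a slip in the format (e.g. the
`Fin N → Fin N` slot discipline) — the finiteness argument is standard. [cite: BasuPollackRoy2006,
Thm 2.77 and §2.3] [cite: BochnakCosteRoy1998, Prop. 2.2.4] -/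
theorem stub_gaugeTransfer :
    ∀ N : ℕ, ∃ N' : ℕ, ∀ (c : KZ.RawFormal) (ε : ℝ), KZ.TameCert N c ε → BprCert N' c ε := by
  sorry

/-- **STUB S2 — MONOTONICITY OF THE INEQUALITY COST IN `ε`** (pad by a box; provable now; size M/L).
For every size `N` there is `N'` such that for every formal combination `c` and all scales
`0 ≤ ε ≤ ε' ≤ 1`, `inequalityCost c ε ≤ N → inequalityCost c ε' ≤ N'`. Construction: from
`c + [[0,ε]] − [p] = Σ mᵢ` pass to `c + [[0,ε']] − [p'] = Σ m'ⱼ` by one domain-additivity move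
`[[0,ε']] − [[0,ε]] − [[ε,ε']]` (overlap `{ε}` null), `≤ N` Newton–Leibniz lifts of the slab `[ε, ε']` to
the dimension of `p` (primitive `F(x,s) = s`, `|F| ≤ 1`), one translation off the box `[−N, N]ᵏ`
(change of variables, Jacobian `1`) and one gluing move `p' = p ⊔ slab` (integrand still `≥ 0`); every
template has bounded code, whence `N' = N'(N)` (`KZ.TameCert.of_sub_eq_sum`, `KZ.TameCert.mono`,
`KZ.exists_forall_tameAdm_epsInterval` are the patterns). Why it might fail: it should not — the only
delicate point is the dimension-`0` positive pair (`p` a point mass), lifted by one Newton–Leibniz move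
first. [cite: Viusos2020, §4 (Remark 4.1)] [cite: KontsevichZagier2001, §1.2] -/
theorem stub_padScale :
    ∀ N : ℕ, ∃ N' : ℕ, ∀ (c : KZ.RawFormal) (ε ε' : ℝ), 0 ≤ ε → ε ≤ ε' → ε' ≤ 1 →
      KZ.inequalityCost c ε ≤ N → KZ.inequalityCost c ε' ≤ N' := by
  sorry

/-- **STUB S3 — BOUNDED COST AT COFINALLY SMALL SCALES** (the thesis proper, weakened to a liminf;
conjecture-grade, the transcendence-bearing stub). For bounded `ℚ`-semialgebraic sets
`σA, σB ⊆ [−N₀, N₀]ⁿ` of EQUAL VOLUME there is one size `N` such that one-sided certificates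
`[σA] − [σB] + [[0,ε]] − [p] = Σ_{i<N} mᵢ` of size `≤ N` exist at arbitrarily small scales:
`∀ δ > 0, ∃ ε ∈ (0, δ), inequalityCost (volGen n σA − volGen n σB) ε ≤ N` — "inequality proofs do not
get harder along SOME sequence of scales `ε ↓ 0`" (`liminf_{ε→0⁺} N_c(ε) < ∞`), the output of any
self-similar / geometric-ladder packing engine. Honest status: OPEN — for tame-equivalent pairs it holds
with all scales (`KZ.exists_forall_inequalityCost_le_of_mem_closure`); in general it is Conjecture 1
for the pair `(σA, σB)` modulo the route's squeeze (first-order levels make "cofinal" as good as "an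
initial interval") and tame conservativity; for an inaccessible pair (route Neg's triplication pair
0312) `N_c(ε) → ∞` would refute it and, with the squeeze, Conjecture 1. Why it might fail: exactly
that. [cite: Viusos2020, §4 (Lemmas 4.1–4.3, Remark 4.1)] [cite: KontsevichZagier2001, §1.2
Conjecture 1] [cite: CressonViusos2022, §1] -/
theorem stub_cofinalBoundedCost :
    ∀ (n N₀ : ℕ) (σA σB : Set (Fin n → ℝ)),
      Literature.ModelTheory.ExponentialFields.IsSemialgebraic ℚ σA →
      Literature.ModelTheory.ExponentialFields.IsSemialgebraic ℚ σB →
      (∀ x ∈ σA, ∀ i, |x i| ≤ (N₀ : ℝ)) → (∀ x ∈ σB, ∀ i, |x i| ≤ (N₀ : ℝ)) →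
      MeasureTheory.volume σA = MeasureTheory.volume σB →
        ∃ N : ℕ, ∀ δ : ℝ, 0 < δ → ∃ ε : ℝ, 0 < ε ∧ ε < δ ∧
          KZ.inequalityCost (KZ.volGen n σA - KZ.volGen n σB) ε ≤ N := by
  sorry

/-! ### Consistency: each named statement IS its registered stub (definitionally) -/

theorem gaugeTransfer_holds : GaugeTransfer := stub_gaugeTransfer
theorem padScale_holds : PadScale := stub_padScale
theorem cofinalBoundedCost_holds : CofinalBoundedCost := stub_cofinalBoundedCost

/-! ### Name-keyed aliases of the three statements — the hypotheses of `BoundedCost_of`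

The native skeleton audit (`#h21_check_skeleton`) admits a hypothesis of a skeleton theorem only if its
head constant is a registered obligation or is NAMED like a declared stub; `__Registered.stub_X` is the
statement of `stub_X` under that name (device of `Cruxes/SecondLyndonLemniscatic/Lines/birth.lean`; the
`@[stub]` attribute is gate-reserved and not written here). Each alias is `rfl`-equal to its statement. -/
namespace __Registered

/-- Alias of `GaugeTransfer` keyed by the registered stub name. -/
abbrev stub_gaugeTransfer : Prop := GaugeTransfer
/-- Alias of `PadScale` keyed by the registered stub name. -/
abbrev stub_padScale : Prop := PadScale
/-- Alias of `CofinalBoundedCost` keyed by the registered stub name. -/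
abbrev stub_cofinalBoundedCost : Prop := CofinalBoundedCost

end __Registered

/-! ### Sanity: the liminf stub is inhabited-in-kind (no `sorry`) -/

/-- Special case of `stub_cofinalBoundedCost` with no `sorry`: for `σA = σB` the cost is bounded at
ALL scales in `[0, 1]` (tree: `KZ.exists_forall_inequalityCost_sub_self_le`), hence at cofinally small
ones. Shows the statement's shape computes. [cite: Viusos2020, §4] -/
theorem cofinalBoundedCost_self (n : ℕ) (σ : Set (Fin n → ℝ)) :
    ∃ N : ℕ, ∀ δ : ℝ, 0 < δ → ∃ ε : ℝ, 0 < ε ∧ ε < δ ∧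
      KZ.inequalityCost (KZ.volGen n σ - KZ.volGen n σ) ε ≤ N := by
  obtain ⟨N, hN⟩ := KZ.exists_forall_inequalityCost_sub_self_le (KZ.volGen n σ)
  refine ⟨N, fun δ hδ => ⟨min (δ / 2) (1 / 2), ?_, ?_, hN _ ?_ ?_⟩⟩
  · exact lt_min (by linarith) (by norm_num)
  · exact (min_le_left _ _).trans_lt (by linarith)
  · exact (lt_min (by linarith) (by norm_num)).le
  · exact (min_le_right _ _).trans (by norm_num)

/-! ### The composition (sorry-free) -/

/-- **Skeleton theorem, arrow form** (concludes the crux BY NAME; type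
`stub_gaugeTransfer-sig → stub_padScale-sig → stub_cofinalBoundedCost-sig → BoundedCost`, the hypotheses
spelled through the name-keyed aliases): gauge transfer → padding in `ε` → cofinal bounded cost →
`BoundedCost`.
For tame volume forms the values are the volumes of the domains (integrand `1`, measurable
`ℚ`-semialgebraic domains), finite because the domains lie in the compact box `[−N₀, N₀]ⁿ`, so
`A.value = B.value` gives `volume A.domain = volume B.domain`; S3 yields a size `N₁` certifying
arbitrarily small scales; a rational `ε ∈ (0,1)` is reached from a certified scale `ε₀ < ε` by S2
(size `N₂(N₁)`), and S1 moves the certificate into the crux's gauge (size `N₃(N₂)`, uniform in `ε`).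
[cite: KontsevichZagier2001, §1.2] [cite: Viusos2020, §4] -/
theorem BoundedCost_of (h₁ : __Registered.stub_gaugeTransfer) (h₂ : __Registered.stub_padScale)
    (h₃ : __Registered.stub_cofinalBoundedCost) :
    BoundedCost := by
  rw [boundedCost_iff]
  intro n N₀ A B hA hA1 hB hB1 hval
  -- Step 0: for volume forms, equal values are equal (finite) volumes of the domains.
  have hreal : ∀ R : KZ.IntegralRep n, Set.EqOn R.integrand 1 R.domain →
      R.value = volume.real R.domain := fun R hR => by
    rw [KZ.IntegralRep.value, setIntegral_congr_fun (KZ.IntegralRep.measurableSet_domain_holds R) hR]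
    simp only [Pi.one_apply, setIntegral_const, smul_eq_mul, mul_one]
  have hfin : ∀ σ : Set (Fin n → ℝ), (∀ x ∈ σ, ∀ i, |x i| ≤ (N₀ : ℝ)) → volume σ ≠ ⊤ := by
    intro σ hσ
    have hsub : σ ⊆ Metric.closedBall (0 : Fin n → ℝ) N₀ := fun x hx => by
      rw [mem_closedBall_zero_iff, pi_norm_le_iff_of_nonneg (Nat.cast_nonneg N₀)]
      intro i
      rw [Real.norm_eq_abs]
      exact hσ x hx i
    exact ((measure_mono hsub).trans_lt (isCompact_closedBall _ _).measure_lt_top).ne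
  have hvol : volume A.domain = volume B.domain := by
    have h := hval
    rw [hreal A hA1, hreal B hB1, measureReal_def, measureReal_def,
      ENNReal.toReal_eq_toReal_iff' (hfin _ hA) (hfin _ hB)] at h
    exact h
  -- Steps 1–3: cofinal bounded cost; pad up to the given rational scale; change the gauge.
  obtain ⟨N₁, hN₁⟩ :=
    h₃ n N₀ A.domain B.domain A.isSemialgebraic_domain B.isSemialgebraic_domain hA hB hvol
  obtain ⟨N₂, hN₂⟩ := h₂ N₁
  obtain ⟨N₃, hN₃⟩ := h₁ N₂
  refine ⟨N₃, fun ε hε hε1 => ?_⟩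
  have hεR : (0 : ℝ) < ε := by exact_mod_cast hε
  have hε1R : (ε : ℝ) ≤ 1 := by exact_mod_cast hε1.le
  obtain ⟨ε₀, hε₀, hε₀ε, hc⟩ := hN₁ ε hεR
  exact hN₃ _ _ (KZ.inequalityCost_le_iff.mp (hN₂ _ ε₀ ε hε₀.le hε₀ε.le hε1R hc))

/-- **Skeleton theorem, by name**: `BoundedCost` from the three registered stubs (its only `sorryAx`
dependencies are `stub_gaugeTransfer`, `stub_padScale`, `stub_cofinalBoundedCost`).
[cite: KontsevichZagier2001, §1.2] -/
theorem BoundedCost_skeleton : BoundedCost :=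
  BoundedCost_of stub_gaugeTransfer stub_padScale stub_cofinalBoundedCost

end Summit.KontsevichZagierPeriods.KontsevichZagierPeriods.Cruxes.BoundedCost.Birth
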